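import Mathlib
import HarnessLib
import Summits.KontsevichZagierPeriods.KontsevichZagierPeriods.Theses.FurushoPentagon
import Literature.NumberTheory.Transcendental.AssociatorsDoubleShuffleProofs

/-!
# Route FurushoPentagon — `FurushoOverReduced`: Furusho's theorem over reduced `ℚ`-algebras

Item stmt-KontsevichZagierPeriods-11351 (support, the lever of route FurushoPentagon).

**Statement.** For every REDUCED commutative `ℚ`-algebra `R` and every group-like
`φ ∈ R⟨⟨X₀, X₁⟩⟩` (`NCSeries.IsGroupLike`) satisfying Drinfeld's pentagon equation
(`NCSeries.DrinfeldPentagon`), the series shuffle regularisation `φ_*` satisfies the generalised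
double shuffle relation `Δ_*(φ_*) = φ_* ⊗̂ φ_*` (`NCSeries.GeneralisedDoubleShuffle`).

**Proof.** Over a field of characteristic `0` this is Furusho's theorem [Furusho2011, Thm 1.2],
in the tree as the theorem `furusho_pentagon_doubleShuffle_holds`
(`Literature/NumberTheory/Transcendental/AssociatorsDoubleShuffleProofs.lean`). For a reduced `R`
we descend along the residue fields: for a prime `𝔭 ⊂ R` put `K := Frac(R ⧸ 𝔭)`, a field of
characteristic `0` because `ℚ → R ⧸ 𝔭` is injective (`R ⧸ 𝔭` is a non-trivial `ℚ`-algebra), and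
`g : R → R ⧸ 𝔭 → K`. Group-likeness and the pentagon are preserved by change of coefficients
(`IsGroupLike.map`, `DrinfeldPentagon.map`), and `(map g φ)_* = map g (φ_*)`
(`seriesShuffleReg_map`), so Furusho's theorem in `K` says that `g` kills the defect
`φ_*(u) φ_*(v) - Σ_{w ∈ u ∗ v} φ_*(w)`, i.e. the defect lies in `𝔭`. Lying in every prime, the
defect is nilpotent (`nilpotent_iff_mem_prime`), hence `0` since `R` is reduced. The degenerate
case `R = 0` is covered uniformly (no primes; every element is `0`).

References: H. Furusho, *Double shuffle relation for associators*, Ann. of Math. 174 (2011),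
Thm 1.2 [Furusho2011]; G. Racinet, Publ. Math. IHÉS 95 (2002), Def. 3.1 [Racinet2002].
-/

noncomputable section

open Literature.NumberTheory.Transcendental
open Literature.NumberTheory.Transcendental.NCSeries
open Summit.KontsevichZagierPeriods.KontsevichZagierPeriods.Theses.FurushoPentagon (FurushoOverReduced)

namespace Summit.KontsevichZagierPeriods.FurushoPentagon.FurushoOverReduced

/-- **Furusho's theorem after a change of coefficients to a field.** For a commutative
`ℚ`-algebra `R`, a group-like pentagon solution `φ ∈ R⟨⟨X₀, X₁⟩⟩` and a ring map `g : R → K` to a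
field of characteristic `0`, the generalised double shuffle defect
`φ_*(u) φ_*(v) - Σ_{w ∈ u ∗ v} φ_*(w)` is killed by `g`: `map g φ` is a group-like pentagon
solution over `K` (`IsGroupLike.map`, `DrinfeldPentagon.map`), [Furusho2011, Thm 1.2]
(`furusho_pentagon_doubleShuffle_holds`) applies to it, and `(map g φ)_* = map g (φ_*)`
(`seriesShuffleReg_map`). [cite: Furusho2011, Thm 1.2] -/
theorem map_defect_eq_zero {R : Type} [CommRing R] [Algebra ℚ R] {φ : NCSeries Bool R}
    (hg : IsGroupLike φ) (h5 : DrinfeldPentagon φ) {K : Type} [Field K] [CharZero K]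
    (g : R →+* K) {u v : List ℕ} (hu : ∀ i ∈ u, 1 ≤ i) (hv : ∀ i ∈ v, 1 ≤ i) :
    g (seriesShuffleReg φ u * seriesShuffleReg φ v -
      ((MZV.stuffle u v).map (seriesShuffleReg φ)).sum) = 0 := by
  rw [map_sub, map_mul, map_list_sum, List.map_map, sub_eq_zero]
  have hK := furusho_pentagon_doubleShuffle_holds K (NCSeries.map g φ) (hg.map g) (h5.map g)
    u v hu hv
  rw [seriesShuffleReg_map] at hK
  exact hK

/-- **The defect lies in every prime.** For a prime ideal `𝔭` of a commutative `ℚ`-algebra `R`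
and a group-like pentagon solution `φ ∈ R⟨⟨X₀, X₁⟩⟩`, the generalised double shuffle defect
`φ_*(u) φ_*(v) - Σ_{w ∈ u ∗ v} φ_*(w)` lies in `𝔭`: apply `map_defect_eq_zero` to
`R → R ⧸ 𝔭 → Frac(R ⧸ 𝔭)`, a field of characteristic `0` (`ℚ ↪ R ⧸ 𝔭 ↪ Frac(R ⧸ 𝔭)`), and use
the injectivity of `R ⧸ 𝔭 → Frac(R ⧸ 𝔭)`. [cite: Furusho2011, Thm 1.2] -/
theorem defect_mem_prime {R : Type} [CommRing R] [Algebra ℚ R] {φ : NCSeries Bool R}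
    (hg : IsGroupLike φ) (h5 : DrinfeldPentagon φ) {P : Ideal R} (hP : P.IsPrime)
    {u v : List ℕ} (hu : ∀ i ∈ u, 1 ≤ i) (hv : ∀ i ∈ v, 1 ≤ i) :
    seriesShuffleReg φ u * seriesShuffleReg φ v -
      ((MZV.stuffle u v).map (seriesShuffleReg φ)).sum ∈ P := by
  haveI : CharZero (R ⧸ P) :=
    charZero_of_injective_algebraMap (algebraMap ℚ (R ⧸ P)).injective
  haveI : CharZero (FractionRing (R ⧸ P)) :=
    charZero_of_injective_algebraMap (IsFractionRing.injective (R ⧸ P) (FractionRing (R ⧸ P)))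
  have h0 := map_defect_eq_zero hg h5
    ((algebraMap (R ⧸ P) (FractionRing (R ⧸ P))).comp (Ideal.Quotient.mk P)) hu hv
  rw [RingHom.comp_apply,
    map_eq_zero_iff _ (IsFractionRing.injective (R ⧸ P) (FractionRing (R ⧸ P)))] at h0
  exact Ideal.Quotient.eq_zero_iff_mem.mp h0

/-- **Furusho's theorem [Furusho2011, Thm 1.2] over reduced commutative `ℚ`-algebras** — closes
item stmt-KontsevichZagierPeriods-11351 (`FurushoOverReduced`): a group-like solution of Drinfeld's
pentagon equation with coefficients in a reduced commutative `ℚ`-algebra satisfies the generalised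
double shuffle relation. Field case = `furusho_pentagon_doubleShuffle_holds`; descent along the
residue fields `Frac(R ⧸ 𝔭)` (`defect_mem_prime`): the defect lies in every prime, hence is
nilpotent (`nilpotent_iff_mem_prime`), hence `0` in the reduced ring `R`.
[cite: Furusho2011, Thm 1.2] -/
theorem furushoOverReduced_proof : FurushoOverReduced := by
  intro R _ _ _ φ hg h5 u v hu hv
  rw [← sub_eq_zero]
  exact (nilpotent_iff_mem_prime.mpr fun P hP => defect_mem_prime hg h5 hP hu hv).eq_zero

end Summit.KontsevichZagierPeriods.FurushoPentagon.FurushoOverReduced
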